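import Summits.QuantumFields.BalabanUV.T4Continuum.Support.NE7ApeFlatEndOfRobustEnd
import Summits.QuantumFields.BalabanUV.T4Continuum.Support.NE7FlatDatumNormalForm
import Summits.QuantumFields.BalabanUV.T4Continuum.Support.NE7CommutingUnitaryLogs
import Summits.QuantumFields.BalabanUV.T4Continuum.Support.NE7TangentCriticalCover
import Summits.QuantumFields.BalabanUV.T4Continuum.Support.NE7SmallFieldBootstrap
import HarnessLib

/-!
# NE7ApeFlatEndOfRobustConst — THE REDUCTION IN ITS BENIGN FORM: a ROBUST (APE) END on the fibres over CONSTANT COMMUTING data `e^{Y_i∕N′}`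
# (periodic setting, (N′)-uniform defect `+ C·max_i ‖e^{Y_i} − 1‖`) gives the END on the fibre over EVERY flat datum, infinite-order holonomy included

Cell `pub-balaban`, rung (B)+1 sub-cell t4, lineage `b2b-balaban-t4-ne7-p2`, generation 89 (CRUX PROVER NE7 #2 = co-owner of row NE7, kernel hand); file (T″)
of the gen-89 line, over (T′) `NE7ApeFlatEndOfRobustEnd` (closedness of the small-field class), (R) `NE7AxisHolonomyRecurrence` (Kronecker recurrence of the
axis holonomies on the covers), (G1) `NE7CommutingUnitaryLogs` (commuting skew-Hermitian logs), (G2) `NE7FlatDatumNormalForm` (flat = constant up to a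
PERIODIC gauge), (C1) `NE7TangentCriticalCover` (criticality lifts to covers) and the OWNER's gauge covariance `NE7TanCriticalGauge`.
WHY.  T′ reduced the flat stratum to a robust END stated on arbitrary flat data with almost-trivial axis holonomies.  With the normal form the hypothesis
can be taken in the most benign form the OWNER's ROAD v4 could attack: the datum is a CONSTANT commuting configuration `r_i = e^{Y_i∕N′}` on the period-`N′`
coarse torus (a constant background), and the defect is measured by the TOTAL axis holonomies `‖e^{Y_i} − 1‖ ≤ η` (NOT by the per-link size `‖r_i − 1‖ ~ π∕N′`,
which is not a small parameter: a constant background of total phase θ moves the charged low modes by a Bloch momentum θ∕period, comparable with the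
lowest torus momentum).  Proof of the reduction: fix a flat datum and `ε > 0`; on the `m`-fold cover with `m` from (R) the `(N·m)`-fold axis holonomies `τ_i`
are within `ε∕C` of `1` and pairwise commute (`hol_seg_comm_of_flat`: flat ⟹ abelian holonomy); (G1) gives commuting skew logs, (G2) a periodic unitary `G`
with `cavgIter (U^{G}) = const e^{Y∕(N·m)}`; `U^{G}` inherits the class, the radii and tangent-criticality at period `M·N·m` ((C1) + `tanCritical_gaugeAct`);
the robust END gives `SmallField U^{G} (K′δ²∕M² + ε)`, gauge back, let `ε → 0` (T′ `smallField_of_forall_pos`).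
WHAT ([folklore]; 0 def, 0 sorry).  §1 `hol_seg_comm_of_flat` (the axis holonomies of a flat periodic unitary configuration commute).  §2
**`smallField_of_tanCritical_flatDatum_of_robustConst`** — displayed hypothesis `hRobustConst` (NOT proved anywhere) ⟹ the END over every flat datum.  §3 (v2)
**`exists_pureGauge_of_tanCritical_flatDatum_of_robustConst`** — the same hypothesis ⟹ RIGIDITY over every flat datum (critical points are pure gauges;
bootstrap (B) `NE7SmallFieldBootstrap`).  §4 (v3) `hol_plaqWord_const_expUnit_eq_one` (constant commuting data are flat) and **`robustConst_of_flatDatumEnd`** — the CONVERSE: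
the END over every flat datum gives `hRobustConst` back with any `C ≥ 0`, so T″ is an EQUIVALENCE (the reduction loses nothing).
HONEST FRAMING (page 1): a reduction with a displayed unproved hypothesis; compositions BY NAME; nothing of Bałaban's asserted; moves no letter by itself; the
robust END is the open problem; (APE) on the data class `𝒟_β` NOT proved; NE7 NOT PRINTED ∕ NOT PROVED; spine PROVED 0∕9; FIXED FINITE T⁴, rung (B)+1 — NOT
infinite volume, NOT mass gap, NOT BetaPertH, NOT Clay.  Continuum YM on T⁴ ⇐ BetaPertH ∧ nine spine estimates (0/9 proved); BetaPertH ⇐ (D1) ∧ (D4) ∧ CAP+tail;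
G-an2-4 gates asym, D1 and NE2/3/4.
-/

set_option autoImplicit false

open scoped BigOperators Matrix.Norms.L2Operator
open NormedSpace Finset

namespace Summit.QuantumFields.BalabanUV.T4Continuum.NE7ApeFlatEndOfRobustConst

open Literature.MathematicalPhysics.QuantumFieldTheory.Balaban1983to89
open B7Prop1Explicit B7Prop2Explicit
open T4AveragingDeficitWall (IsUnitaryCfg IsSkewDir SmallField hol_flat)
open T4AveragingDeficitWallBoundary (IsPeriodicCfg)
open AveragingDeficitPeriodicCounting (IsPeriodicDir)
open AveragingDeficitMultiLevelPrep (cavgIter LevelSmall cavgIter_unitary_small isPeriodicCfg_cavgIter)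
open MinimalActionLevels (perWin)
open MinimalActionWitness (flatCfg)
open NE3HessForm (dAction)
open NE3TangentCovariantTower (dirIter)
open NE3QbarIterCovLiftPrep (cruxC)
open NE3RightInverseSolveLetters (thetaLoc)
open NE3SmoothLiftW (tower_eq_pow_mul isPeriodicCfg_gaugeAct)
open NE3EnergyShapes (IsUnitarySite IsPeriodicSite)
open NE3EnergyRateFlatClass (exists_unitary_gauge_eq_gaugeAct_flatCfg)
open NE7EtaBackgroundFlatStratum (apply_add_period_eq_of_isPeriodicCfg gaugeAct_mul_const_flatCfg)
open AveragingDeficitKDatum (isUnitaryCfg_gaugeAct gaugeAct_inv_gaugeAct)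
open BlockAverageCurrent (smallField_gaugeAct)
open NE7TanCriticalGauge (tanCritical_gaugeAct)
open NE7TangentCriticalCover (tanCritical_cover isPeriodicCfg_mul)
open NE7AxisHolonomyRecurrence (exists_axis_holonomy_pow_near_one)
open NE7ApeFlatEndOfRobustEnd (smallField_of_forall_pos)
open NE7FlatDatumNormalForm (exists_periodic_gauge_cavgIter_eq_const)
open NE7CommutingUnitaryLogs (exists_commuting_skewAdjoint_log)
open NE7SmallFieldBootstrap (smallField_zero_of_bootstrap hol_plaqWord_eq_one_of_smallField_zero)
open BlockAveragePushDirSplit (flat)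

noncomputable section

variable {d : ℕ} {n : Type*} [Fintype n] [DecidableEq n]

/-! ## §1 Flat ⟹ abelian holonomy: the axis holonomies of a flat periodic configuration commute -/

/-- **THE AXIS HOLONOMIES OF A FLAT PERIODIC UNITARY CONFIGURATION COMMUTE** (based at `0`): with the normalised quasi-periodic gauge `w` (`D = 1^{w}`,
`w 0 = 1`, `w(y + Pe_i) = w(y)·c_i`) one has `D([0,Pe_i]) = c_i⁻¹` and `c_i c_j = w(Pe_i + Pe_j) = c_j c_i`. [folklore] -/
theorem hol_seg_comm_of_flat [Nonempty n] {D : Site d → Fin d → (Matrix n n ℂ)ˣ} (hDu : IsUnitaryCfg D) {P : ℤ} (hDP : IsPeriodicCfg D P)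
    (hflat : ∀ (y : Site d) (κ μ : Fin d), κ ≠ μ → hol D y (plaqWord κ μ) = 1) (i j : Fin d) :
    hol D 0 (seg i P) * hol D 0 (seg j P) = hol D 0 (seg j P) * hol D 0 (seg i P) := by
  obtain ⟨w', hw'u, hDw'⟩ := exists_unitary_gauge_eq_gaugeAct_flatCfg hDu hflat
  set w : Site d → (Matrix n n ℂ)ˣ := fun y => w' y * (w' 0)⁻¹ with hw
  have hDw : D = gaugeAct w flatCfg := by rw [hDw', hw, gaugeAct_mul_const_flatCfg]
  have hw0 : w 0 = 1 := by simp [hw]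
  have hDPw : IsPeriodicCfg (gaugeAct w (flatCfg : Site d → Fin d → (Matrix n n ℂ)ˣ)) P := by rw [← hDw]; exact hDP
  have hq : ∀ (y : Site d) (κ : Fin d), w (y + P • e κ) = w y * w (P • e κ) := by
    intro y κ
    rw [apply_add_period_eq_of_isPeriodicCfg hDPw y κ, hw0, inv_one, one_mul]
  have hτ : ∀ κ : Fin d, hol D 0 (seg κ P) = (w (P • e κ))⁻¹ := by
    intro κ
    rw [hDw, hol_gaugeAct, disp_seg, zero_add, hw0, one_mul]
    have h1 : hol (flatCfg : Site d → Fin d → (Matrix n n ℂ)ˣ) 0 (seg κ P) = 1 := hol_flat _ _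
    rw [h1, one_mul]
  have hcomm : w (P • e i) * w (P • e j) = w (P • e j) * w (P • e i) := by
    have h1 : w (P • e i + P • e j) = w (P • e i) * w (P • e j) := hq _ _
    have h2 : w (P • e j + P • e i) = w (P • e j) * w (P • e i) := hq _ _
    rw [← h1, ← h2, add_comm]
  rw [hτ i, hτ j, ← mul_inv_rev, ← mul_inv_rev, hcomm]

/-! ## §2 The reduction over constant commuting data -/

/-- **THE END OVER EVERY FLAT DATUM FROM A ROBUST END AT CONSTANT COMMUTING DATA.**  Hypothesis `hRobustConst` (NOT proved in the tree): `K′, θ, C` such that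
for all `N′ ≥ 1`, `k`, every unitary `(L^{k+1}N′)`-periodic `U` of the multi-level class (`SmallField U x`, `LevelSmall`, the three window conditions),
`SmallField U (δ∕M²)`, `0 ≤ δ ≤ θ`, `δ∕M² ≤ x`, tangent-critical at period `L^{k+1}N′`, whose `(k+1)`-fold average IS THE CONSTANT commuting configuration
`(y,i) ↦ e^{Y_i∕N′}` (`Y_i` skew-Hermitian, pairwise commuting, `‖e^{Y_i} − 1‖ ≤ η`): `SmallField U (K′δ²∕M² + C·η)`.  Conclusion: for every `U` of the class
whose `(k+1)`-fold average is FLAT (coarse plaquettes `1`; NO holonomy hypothesis): `SmallField U (K′δ²∕M²)`. [folklore] -/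
theorem smallField_of_tanCritical_flatDatum_of_robustConst {n : Type} [Fintype n] [DecidableEq n] [Nonempty n] {L : ℕ} (hL : 2 ≤ L) {K' θ C : ℝ}
    (hC : 0 < C)
    (hRobustConst : ∀ (N' : ℕ) [NeZero N'] (k : ℕ)
      {U : Site (d + 1) → Fin (d + 1) → (Matrix n n ℂ)ˣ} (_hU : IsUnitaryCfg U) {x δ η : ℝ} (_hx : 0 ≤ x) (_hs : LevelSmall (d + 1) L k x)
      (_hUx : SmallField U x) (_hδ : 0 ≤ δ) (_hUδ : SmallField U (δ / ((L : ℝ) ^ (k + 1)) ^ 2)) (_hδx : δ / ((L : ℝ) ^ (k + 1)) ^ 2 ≤ x)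
      (_hcritU : ∀ φ : Site (d + 1) → Fin (d + 1) → Matrix n n ℂ, IsSkewDir φ → IsPeriodicDir φ ((L ^ (k + 1) * N' : ℕ) : ℤ) →
        dirIter L (k + 1) U φ = 0 → dAction U φ (perWin (d + 1) (L ^ (k + 1) * N')) = 0)
      (Y : Fin (d + 1) → Matrix n n ℂ) (_hYs : ∀ i, Y i ∈ skewAdjoint (Matrix n n ℂ)) (_hYc : ∀ i j, Commute (Y i) (Y j))
      (_hYη : ∀ i, ‖exp (Y i) - 1‖ ≤ η)
      (_hconst : cavgIter L (k + 1) U = fun (_ : Site (d + 1)) (i : Fin (d + 1)) => expUnit (((N' : ℂ))⁻¹ • Y i))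
      (_hUP : IsPeriodicCfg U ((L ^ (k + 1) * N' : ℕ) : ℤ))
      (_hθ : cruxC (d + 1) L * (((L : ℝ) ^ (k + 1)) ^ 2 * x) < 1) (_hθl : thetaLoc (d + 1) L * (((L : ℝ) ^ (k + 1)) ^ 2 * x) ≤ 1 / 2)
      (_hε : ((L : ℝ) ^ (k + 1)) ^ 2 * x ≤ 1) (_hδθ : δ ≤ θ),
      SmallField U (K' * δ ^ 2 / ((L : ℝ) ^ (k + 1)) ^ 2 + C * η))
    (N : ℕ) [NeZero N] (k : ℕ)
    {U : Site (d + 1) → Fin (d + 1) → (Matrix n n ℂ)ˣ} (hU : IsUnitaryCfg U) {x δ : ℝ} (hx : 0 ≤ x) (hs : LevelSmall (d + 1) L k x)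
    (hUx : SmallField U x) (hδ : 0 ≤ δ) (hUδ : SmallField U (δ / ((L : ℝ) ^ (k + 1)) ^ 2)) (hδx : δ / ((L : ℝ) ^ (k + 1)) ^ 2 ≤ x)
    (hcritU : ∀ φ : Site (d + 1) → Fin (d + 1) → Matrix n n ℂ, IsSkewDir φ → IsPeriodicDir φ ((L ^ (k + 1) * N : ℕ) : ℤ) →
      dirIter L (k + 1) U φ = 0 → dAction U φ (perWin (d + 1) (L ^ (k + 1) * N)) = 0)
    (hflatD : ∀ (y : Site (d + 1)) (κ μ : Fin (d + 1)), κ ≠ μ → hol (cavgIter L (k + 1) U) y (plaqWord κ μ) = 1)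
    (hUP : IsPeriodicCfg U ((L ^ (k + 1) * N : ℕ) : ℤ))
    (hθ : cruxC (d + 1) L * (((L : ℝ) ^ (k + 1)) ^ 2 * x) < 1) (hθl : thetaLoc (d + 1) L * (((L : ℝ) ^ (k + 1)) ^ 2 * x) ≤ 1 / 2)
    (hε : ((L : ℝ) ^ (k + 1)) ^ 2 * x ≤ 1) (hδθ : δ ≤ θ) :
    SmallField U (K' * δ ^ 2 / ((L : ℝ) ^ (k + 1)) ^ 2) := by
  have hL1 : 1 ≤ L := by omega
  have hN1 : 1 ≤ N := Nat.one_le_iff_ne_zero.mpr (NeZero.ne N)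
  -- the datum is unitary and `N`-periodic
  have hDu : IsUnitaryCfg (cavgIter L (k + 1) U) := (cavgIter_unitary_small hL1 k hU hx hs hUx).1
  have hDP : IsPeriodicCfg (cavgIter L (k + 1) U) (N : ℤ) := by
    refine isPeriodicCfg_cavgIter L N (k + 1) ?_
    rw [tower_eq_pow_mul]
    exact hUP
  refine smallField_of_forall_pos fun ε hεpos => ?_
  -- (R): a cover on which every axis holonomy is within `ε∕C` of `1`
  obtain ⟨m, hm, hmε⟩ := exists_axis_holonomy_pow_near_one hDu hDP (div_pos hεpos hC)
  haveI : NeZero m := ⟨by omega⟩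
  haveI : NeZero (N * m) := ⟨Nat.mul_ne_zero (NeZero.ne N) (NeZero.ne m)⟩
  -- the `(N·m)`-fold axis holonomies: commuting unitaries
  set τ : Fin (d + 1) → Matrix n n ℂ := fun i => ((hol (cavgIter L (k + 1) U) 0 (seg i (((N * m : ℕ) : ℤ))) : (Matrix n n ℂ)ˣ) : Matrix n n ℂ)
    with hτdef
  have hτu : ∀ i, τ i ∈ Matrix.unitaryGroup n ℂ := fun i => mem_unitaryUnits.1 (hol_mem_of hDu 0 _)
  have hDPm : IsPeriodicCfg (cavgIter L (k + 1) U) (((N * m : ℕ) : ℤ)) := by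
    have h := isPeriodicCfg_mul hDP (m : ℤ)
    push_cast at h ⊢
    exact h
  have hτc : ∀ i j, Commute (τ i) (τ j) := by
    intro i j
    have h := hol_seg_comm_of_flat hDu hDPm hflatD i j
    have h' := congrArg (fun u : (Matrix n n ℂ)ˣ => (u : Matrix n n ℂ)) h
    have h'' : τ i * τ j = τ j * τ i := by simpa only [Units.val_mul] using h'
    exact h''
  -- (G1): commuting skew logarithms; (G2): the periodic gauge onto the constant datum
  obtain ⟨Y, hYs, hYc, hYexp⟩ := exists_commuting_skewAdjoint_log τ hτu hτc
  have hUPm : IsPeriodicCfg U (((L ^ (k + 1) * (N * m) : ℕ) : ℤ)) := by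
    have h := isPeriodicCfg_mul hUP (m : ℤ)
    have hc : (((L ^ (k + 1) * N : ℕ) : ℤ)) * (m : ℤ) = (((L ^ (k + 1) * (N * m) : ℕ) : ℤ)) := by push_cast; ring
    rwa [hc] at h
  obtain ⟨G, hGu, hGP, hconst⟩ := exists_periodic_gauge_cavgIter_eq_const (P₀ := N * m) hL1 k hU hx hs hUx hUPm hflatD hYs hYc
    (fun i => by rw [hYexp i])
  -- the gauged configuration inherits the class, the radii and tangent-criticality at the cover period
  have hcritm := tanCritical_cover hL1 k hN1 hm hU hx hs hUx hUP hcritU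
  have hVu : IsUnitaryCfg (gaugeAct G U) := isUnitaryCfg_gaugeAct hGu hU
  have hVx : SmallField (gaugeAct G U) x := smallField_gaugeAct hGu hUx
  have hVδ : SmallField (gaugeAct G U) (δ / ((L : ℝ) ^ (k + 1)) ^ 2) := smallField_gaugeAct hGu hUδ
  have hVP : IsPeriodicCfg (gaugeAct G U) (((L ^ (k + 1) * (N * m) : ℕ) : ℤ)) := isPeriodicCfg_gaugeAct hGP hUPm
  have hcritV := tanCritical_gaugeAct hL1 k hU hx hs hUx (P := L ^ (k + 1) * (N * m)) hGu hGP hcritm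
  -- the total holonomy defect
  have hYη : ∀ i, ‖exp (Y i) - 1‖ ≤ ε / C := fun i => by rw [hYexp i]; exact (hmε i).le
  -- the robust END at the constant datum, then back along the gauge
  have hV := hRobustConst (N * m) k hVu hx hs hVx hδ hVδ hδx hcritV Y hYs hYc hYη hconst hVP hθ hθl hε hδθ
  have hback := smallField_gaugeAct (u := fun z => (G z)⁻¹) (fun z => (unitaryUnits (Matrix n n ℂ)).inv_mem (hGu z)) hV
  rw [gaugeAct_inv_gaugeAct] at hback
  have hCε : C * (ε / C) = ε := by field_simp
  rwa [hCε] at hback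


/-! ## §3 … and then rigidity: under the robust END the critical points over EVERY flat datum are pure gauges -/

/-- **RIGIDITY OVER EVERY FLAT DATUM FROM THE ROBUST END AT CONSTANT DATA**: with `hRobustConst` as in §2, `∃ θ₀ > 0` such that every tangent-critical
configuration of the small-field class with `SmallField U (δ∕M²)`, `δ ≤ θ₀`, on the fibre over ANY flat datum is a PURE GAUGE `1^{g}` (§2's END has
`δ`-uniform constants, so (B) `NE7SmallFieldBootstrap.smallField_zero_of_bootstrap` iterates it to radius `0`; zero curvature is pure gauge). [folklore] -/
theorem exists_pureGauge_of_tanCritical_flatDatum_of_robustConst {n : Type} [Fintype n] [DecidableEq n] [Nonempty n] {L : ℕ} (hL : 2 ≤ L)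
    {K' θ C : ℝ} (hK' : 0 < K') (hθ0 : 0 < θ) (hC : 0 < C)
    (hRobustConst : ∀ (N' : ℕ) [NeZero N'] (k : ℕ)
      {U : Site (d + 1) → Fin (d + 1) → (Matrix n n ℂ)ˣ} (_hU : IsUnitaryCfg U) {x δ η : ℝ} (_hx : 0 ≤ x) (_hs : LevelSmall (d + 1) L k x)
      (_hUx : SmallField U x) (_hδ : 0 ≤ δ) (_hUδ : SmallField U (δ / ((L : ℝ) ^ (k + 1)) ^ 2)) (_hδx : δ / ((L : ℝ) ^ (k + 1)) ^ 2 ≤ x)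
      (_hcritU : ∀ φ : Site (d + 1) → Fin (d + 1) → Matrix n n ℂ, IsSkewDir φ → IsPeriodicDir φ ((L ^ (k + 1) * N' : ℕ) : ℤ) →
        dirIter L (k + 1) U φ = 0 → dAction U φ (perWin (d + 1) (L ^ (k + 1) * N')) = 0)
      (Y : Fin (d + 1) → Matrix n n ℂ) (_hYs : ∀ i, Y i ∈ skewAdjoint (Matrix n n ℂ)) (_hYc : ∀ i j, Commute (Y i) (Y j))
      (_hYη : ∀ i, ‖exp (Y i) - 1‖ ≤ η)
      (_hconst : cavgIter L (k + 1) U = fun (_ : Site (d + 1)) (i : Fin (d + 1)) => expUnit (((N' : ℂ))⁻¹ • Y i))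
      (_hUP : IsPeriodicCfg U ((L ^ (k + 1) * N' : ℕ) : ℤ))
      (_hθ : cruxC (d + 1) L * (((L : ℝ) ^ (k + 1)) ^ 2 * x) < 1) (_hθl : thetaLoc (d + 1) L * (((L : ℝ) ^ (k + 1)) ^ 2 * x) ≤ 1 / 2)
      (_hε : ((L : ℝ) ^ (k + 1)) ^ 2 * x ≤ 1) (_hδθ : δ ≤ θ),
      SmallField U (K' * δ ^ 2 / ((L : ℝ) ^ (k + 1)) ^ 2 + C * η)) :
    ∃ θ₀ : ℝ, 0 < θ₀ ∧ ∀ (N : ℕ) [NeZero N] (k : ℕ)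
      {U : Site (d + 1) → Fin (d + 1) → (Matrix n n ℂ)ˣ} (_hU : IsUnitaryCfg U) {x δ : ℝ} (_hx : 0 ≤ x) (_hs : LevelSmall (d + 1) L k x)
      (_hUx : SmallField U x) (_hδ : 0 ≤ δ) (_hUδ : SmallField U (δ / ((L : ℝ) ^ (k + 1)) ^ 2)) (_hδx : δ / ((L : ℝ) ^ (k + 1)) ^ 2 ≤ x)
      (_hcritU : ∀ φ : Site (d + 1) → Fin (d + 1) → Matrix n n ℂ, IsSkewDir φ → IsPeriodicDir φ ((L ^ (k + 1) * N : ℕ) : ℤ) →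
        dirIter L (k + 1) U φ = 0 → dAction U φ (perWin (d + 1) (L ^ (k + 1) * N)) = 0)
      (_hflatD : ∀ (y : Site (d + 1)) (κ μ : Fin (d + 1)), κ ≠ μ → hol (cavgIter L (k + 1) U) y (plaqWord κ μ) = 1)
      (_hUP : IsPeriodicCfg U ((L ^ (k + 1) * N : ℕ) : ℤ))
      (_hθ : cruxC (d + 1) L * (((L : ℝ) ^ (k + 1)) ^ 2 * x) < 1) (_hθl : thetaLoc (d + 1) L * (((L : ℝ) ^ (k + 1)) ^ 2 * x) ≤ 1 / 2)
      (_hε : ((L : ℝ) ^ (k + 1)) ^ 2 * x ≤ 1) (_hδθ : δ ≤ θ₀),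
      ∃ g : Site (d + 1) → (Matrix n n ℂ)ˣ, IsUnitarySite g ∧ U = gaugeAct g flat := by
  have hEND := smallField_of_tanCritical_flatDatum_of_robustConst (d := d) (n := n) hL hC hRobustConst
  refine ⟨min θ (1 / (2 * K')), lt_min hθ0 (by positivity), ?_⟩
  intro N _ k U hU x δ hx hs hUx hδ hUδ hδx hcritU hflatD hUP hθ hθl hε hδθ
  have hM₂ : 0 < ((L : ℝ) ^ (k + 1)) ^ 2 := by positivity
  have hδθ' : δ ≤ θ := hδθ.trans (min_le_left _ _)
  have hKδ : K' * δ ≤ 1 / 2 := by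
    have h1 : δ ≤ 1 / (2 * K') := hδθ.trans (min_le_right _ _)
    calc K' * δ ≤ K' * (1 / (2 * K')) := mul_le_mul_of_nonneg_left h1 hK'.le
      _ = 1 / 2 := by field_simp
  have h0 : SmallField U 0 := by
    refine smallField_zero_of_bootstrap (K := K') (θ := θ) hK'.le hM₂ ?_ hδ hδθ' hKδ hUδ
    intro δ' hδ' hδ'θ hUδ'
    by_cases hδ'x : δ' / ((L : ℝ) ^ (k + 1)) ^ 2 ≤ x
    · exact hEND N k hU hx hs hUx hδ' hUδ' hδ'x hcritU hflatD hUP hθ hθl hε hδ'θ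
    · have hδ'x' : x < δ' / ((L : ℝ) ^ (k + 1)) ^ 2 := not_le.mp hδ'x
      have hxM : x = (x * ((L : ℝ) ^ (k + 1)) ^ 2) / ((L : ℝ) ^ (k + 1)) ^ 2 := by field_simp
      have hδ'' : 0 ≤ x * ((L : ℝ) ^ (k + 1)) ^ 2 := by positivity
      have hlt : x * ((L : ℝ) ^ (k + 1)) ^ 2 ≤ δ' := ((lt_div_iff₀ hM₂).mp hδ'x').le
      have hUδ'' : SmallField U ((x * ((L : ℝ) ^ (k + 1)) ^ 2) / ((L : ℝ) ^ (k + 1)) ^ 2) := by rw [← hxM]; exact hUx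
      have h := hEND N k hU hx hs hUx hδ'' hUδ'' (by rw [← hxM]) hcritU hflatD hUP hθ hθl hε (hlt.trans hδ'θ)
      intro y κ κ' hκ
      refine (h y κ κ' hκ).trans (div_le_div_of_nonneg_right ?_ hM₂.le)
      exact mul_le_mul_of_nonneg_left (pow_le_pow_left₀ hδ'' hlt 2) hK'.le
  exact exists_unitary_gauge_eq_gaugeAct_flatCfg hU (hol_plaqWord_eq_one_of_smallField_zero h0)


/-! ## §4 The reduction loses nothing: constant commuting data are flat, so the END over every flat datum gives `hRobustConst` back -/

/-- A constant configuration of pairwise commuting exponentials `e^{c•Y_i}` is FLAT: every plaquette variable is `1`. [folklore] -/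
theorem hol_plaqWord_const_expUnit_eq_one {Y : Fin d → Matrix n n ℂ} (hYc : ∀ i j, Commute (Y i) (Y j)) (c : ℂ)
    (y : Site d) (κ μ : Fin d) :
    hol (fun (_ : Site d) (i : Fin d) => expUnit (c • Y i)) y (plaqWord κ μ) = 1 := by
  letI : NormedAlgebra ℚ (Matrix n n ℂ) := NormedAlgebra.restrictScalars ℚ ℂ (Matrix n n ℂ)
  have hcomm : expUnit (c • Y κ) * expUnit (c • Y μ) = expUnit (c • Y μ) * expUnit (c • Y κ) := by
    refine Units.ext ?_
    simp only [Units.val_mul, val_expUnit]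
    exact (((hYc κ μ).smul_left c).smul_right c).exp.eq
  rw [B7Prop1Local.hol_plaqWord_eq, hcomm]
  group

/-- **THE CONVERSE (so T″ is an equivalence)**: if the END holds on the fibre over EVERY flat datum (the conclusion shape of §2), then `hRobustConst` holds with
ANY defect constant `C ≥ 0` — constant commuting data `e^{Y∕N′}` are flat, and the defect term only weakens the conclusion. [folklore] -/
theorem robustConst_of_flatDatumEnd {n : Type} [Fintype n] [DecidableEq n] [Nonempty n] {L : ℕ} {K' θ C : ℝ} (hC : 0 ≤ C)
    (hEND : ∀ (N : ℕ) [NeZero N] (k : ℕ)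
      {U : Site (d + 1) → Fin (d + 1) → (Matrix n n ℂ)ˣ} (_hU : IsUnitaryCfg U) {x δ : ℝ} (_hx : 0 ≤ x) (_hs : LevelSmall (d + 1) L k x)
      (_hUx : SmallField U x) (_hδ : 0 ≤ δ) (_hUδ : SmallField U (δ / ((L : ℝ) ^ (k + 1)) ^ 2)) (_hδx : δ / ((L : ℝ) ^ (k + 1)) ^ 2 ≤ x)
      (_hcritU : ∀ φ : Site (d + 1) → Fin (d + 1) → Matrix n n ℂ, IsSkewDir φ → IsPeriodicDir φ ((L ^ (k + 1) * N : ℕ) : ℤ) →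
        dirIter L (k + 1) U φ = 0 → dAction U φ (perWin (d + 1) (L ^ (k + 1) * N)) = 0)
      (_hflatD : ∀ (y : Site (d + 1)) (κ μ : Fin (d + 1)), κ ≠ μ → hol (cavgIter L (k + 1) U) y (plaqWord κ μ) = 1)
      (_hUP : IsPeriodicCfg U ((L ^ (k + 1) * N : ℕ) : ℤ))
      (_hθ : cruxC (d + 1) L * (((L : ℝ) ^ (k + 1)) ^ 2 * x) < 1) (_hθl : thetaLoc (d + 1) L * (((L : ℝ) ^ (k + 1)) ^ 2 * x) ≤ 1 / 2)
      (_hε : ((L : ℝ) ^ (k + 1)) ^ 2 * x ≤ 1) (_hδθ : δ ≤ θ),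
      SmallField U (K' * δ ^ 2 / ((L : ℝ) ^ (k + 1)) ^ 2))
    (N' : ℕ) [NeZero N'] (k : ℕ)
    {U : Site (d + 1) → Fin (d + 1) → (Matrix n n ℂ)ˣ} (hU : IsUnitaryCfg U) {x δ η : ℝ} (hx : 0 ≤ x) (hs : LevelSmall (d + 1) L k x)
    (hUx : SmallField U x) (hδ : 0 ≤ δ) (hUδ : SmallField U (δ / ((L : ℝ) ^ (k + 1)) ^ 2)) (hδx : δ / ((L : ℝ) ^ (k + 1)) ^ 2 ≤ x)
    (hcritU : ∀ φ : Site (d + 1) → Fin (d + 1) → Matrix n n ℂ, IsSkewDir φ → IsPeriodicDir φ ((L ^ (k + 1) * N' : ℕ) : ℤ) →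
      dirIter L (k + 1) U φ = 0 → dAction U φ (perWin (d + 1) (L ^ (k + 1) * N')) = 0)
    (Y : Fin (d + 1) → Matrix n n ℂ) (_hYs : ∀ i, Y i ∈ skewAdjoint (Matrix n n ℂ)) (hYc : ∀ i j, Commute (Y i) (Y j))
    (hYη : ∀ i, ‖exp (Y i) - 1‖ ≤ η)
    (hconst : cavgIter L (k + 1) U = fun (_ : Site (d + 1)) (i : Fin (d + 1)) => expUnit (((N' : ℂ))⁻¹ • Y i))
    (hUP : IsPeriodicCfg U ((L ^ (k + 1) * N' : ℕ) : ℤ))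
    (hθ : cruxC (d + 1) L * (((L : ℝ) ^ (k + 1)) ^ 2 * x) < 1) (hθl : thetaLoc (d + 1) L * (((L : ℝ) ^ (k + 1)) ^ 2 * x) ≤ 1 / 2)
    (hε : ((L : ℝ) ^ (k + 1)) ^ 2 * x ≤ 1) (hδθ : δ ≤ θ) :
    SmallField U (K' * δ ^ 2 / ((L : ℝ) ^ (k + 1)) ^ 2 + C * η) := by
  have hflatD : ∀ (y : Site (d + 1)) (κ μ : Fin (d + 1)), κ ≠ μ → hol (cavgIter L (k + 1) U) y (plaqWord κ μ) = 1 := by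
    intro y κ μ _
    rw [hconst]
    exact hol_plaqWord_const_expUnit_eq_one hYc _ y κ μ
  have h := hEND N' k hU hx hs hUx hδ hUδ hδx hcritU hflatD hUP hθ hθl hε hδθ
  have hη : 0 ≤ η := by
    have h0 := hYη 0
    exact (norm_nonneg _).trans h0
  intro y κ κ' hκ
  exact (h y κ κ' hκ).trans (le_add_of_nonneg_right (mul_nonneg hC hη))

end

end Summit.QuantumFields.BalabanUV.T4Continuum.NE7ApeFlatEndOfRobustConst
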